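import Mathlib.Combinatorics.Hall.Basic
import Summits.CriticalPhenomena.PercolationContinuityZ3.Theorems.PercNearOneGluingNoHeavyLowerTailSahiCombFiveUpSetPassageHall

/-!
# A UNIVERSAL Kleitman matching, part II: the three-set face of the five-up-set inequality as ONE perfect matching (passage form)

Support file of the one-cut programme (crux `NoHeavyLowerTail`, stmt-CriticalPhenomena-4575; lemma factory `prim-lf-1` gen 35,
memo `FROM-prim-lf-1-gen35-SPLICE-FORM-AND-HYBRID-LAW.md` §2; part I = `…FiveUpSetPassageHall`: the passage graph `G*(B,X)` and its Hall
condition).  Cell `prim-masterthm` seat P5 (gen 20, memo COMBO1 §6(3)) asked for the matching (Hall) structure behind the five-up-set inequality,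
to be proved "directly".  Its three-set face (= hybrid Kleitman (★3′), `FiveUpSet.hybridKleitmanIneq_holds`; = the splice inequality of
`…FiveUpSetSplice`) is a ONE-PARAMETER FAMILY of Hall statements (one for every cut).  Parts I–II show that the whole family is the Hall
condition of a SINGLE bipartite graph `G*(B,X)` and hence, on cubes, a THEOREM about one matching:

Fix up-sets `B, X` of a finite cube; put `T := B ∩ X` (targets), `S := B ∩ refl X` (sources), `O := refl T \ B` (antipodes of targets lying
outside `B`) and `Q := S \ refl T` (sources that are not antipodes of targets).  Then (`exists_passage`):

  **there is a Kleitman bijection `Φ : refl (B ∩ X) → B ∩ X`, `o ⊆ Φ o`, and an injection `π : Q → O` with `π q ⊆ q ⊆ Φ (π q)`** —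

every source that is not antipodal to a target rides its own antipodal chord, a chord that starts OUTSIDE `B`.  Consequence
(`exists_universal_matching`, "UKM"): there is ONE upward injection `φ : B ∩ refl X ↪ B ∩ X` such that for EVERY up-set `U` the number of
`φ`-edges entering `U` from outside is at most the Kleitman gap `#(U ∩ B ∩ X) − #(U ∩ refl (B ∩ X))`; restricting `φ` to the down-region
`univ \ U` shows that the Kleitman matching problem of that region has deficiency at most this gap — which is exactly (SPLICE)/(★3′) for the
cut `U`, now served by one matching for all cuts simultaneously.

Proof: Hall's marriage theorem (Mathlib `Finset.all_card_le_biUnion_card_iff_exists_injective`) for the graph `G*` with left vertices `O ⊔ S`,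
right vertices `Q × {ff} ⊔ T × {tt}`, edges `o → (q,ff)` (`o ⊆ q`), `o → (t,tt)` (`o ⊆ t`), `s → (t,tt)` (`s ⊆ t`); for a left set with up-closures
`V₁` (of its `O`-part) and `V₂ ⊇ V₁` (of everything) the neighbourhood has `#(Q ∩ V₁) + #(T ∩ V₂)` elements, and Hall's inequality
`#(O ∩ V₁) + #(S ∩ V₂) ≤ #(Q ∩ V₁) + #(T ∩ V₂)` IS the hybrid Kleitman inequality with the cut `univ \ V₁` (part I, `passage_hall_ineq`), as
`#(O ∩ V₁) − #(Q ∩ V₁) = #(V₁ ∩ refl (B ∩ X)) − #(V₁ ∩ B ∩ refl X)`.  `#(O ⊔ S) = #Q + #T`, so the matching is perfect, which threads every `q`.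
Census behind the discovery (memo §2): a greedy search found such a universal matching for every pair of up-sets of `2^n`, `n ≤ 4`, for 4,000
sampled pairs at `n = 5`, and on eleven non-Boolean distributive lattices, never backtracking.  On a general finite distributive lattice the same
Hall computation shows PASSAGE ⟺ `LatticeFiveUpSet.SpliceIneqLattice` (open there).
HONEST LABEL: two theorems on cubes (std axioms) obtained from the already-proved face by Hall's theorem; no progress on `TriWIneq` (a ≥ 2) is
claimed. [this work]
-/
namespace Summit.CriticalPhenomena.PercolationContinuityZ3.Theorems

namespace FiveUpSet

open Finset

variable {α : Type} [DecidableEq α] [Fintype α]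

/-! ### The passage theorem -/

/-- **PASSAGE FORM of the three-set face (a universal Kleitman matching).**  For up-sets `B, X` of a finite cube there are
`Φ, π : Finset α → Finset α` with: `Φ` maps `refl (B ∩ X)` injectively into `B ∩ X` with `o ⊆ Φ o` (a Kleitman bijection of the up-set `B ∩ X`),
and `π` maps `Q := (B ∩ refl X) \ refl (B ∩ X)` injectively into `O := refl (B ∩ X) \ B` with `π q ⊆ q ⊆ Φ (π q)`: every point of `B ∩ refl X`
that is not antipodal to `B ∩ X` lies on its own chord `π q ⊆ Φ (π q)`, a chord starting outside `B`.  Proof: Hall's theorem for the passage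
graph; its Hall inequality is `passage_hall_ineq` (= the splice inequality); perfectness by counting. [this work] -/
theorem exists_passage (B X : Finset (Finset α)) (hB : IsUpperSet (B : Set (Finset α))) (hX : IsUpperSet (X : Set (Finset α))) :
    ∃ Φ π : Finset α → Finset α,
      (∀ o ∈ refl (B ∩ X), Φ o ∈ B ∩ X ∧ o ⊆ Φ o) ∧ Set.InjOn Φ ↑(refl (B ∩ X)) ∧
      (∀ q ∈ (B ∩ refl X) \ refl (B ∩ X), π q ∈ refl (B ∩ X) \ B ∧ π q ⊆ q ∧ q ⊆ Φ (π q)) ∧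
      Set.InjOn π ↑((B ∩ refl X) \ refl (B ∩ X)) := by
  classical
  -- token sets
  set T : Finset (Finset α) := B ∩ X with hT
  set S : Finset (Finset α) := B ∩ refl X with hS
  set O : Finset (Finset α) := refl (B ∩ X) \ B with hO
  set Q : Finset (Finset α) := (B ∩ refl X) \ refl (B ∩ X) with hQ
  set Lft : Finset (Finset α) := O ∪ S with hLft
  have hOS : Disjoint O S := by
    rw [disjoint_left]; intro s hs hs'
    rw [hO, mem_sdiff] at hs; rw [hS, mem_inter] at hs'
    exact hs.2 hs'.1
  -- the passage graph: neighbourhoods in `Finset α × Bool` (`false` = a thread point of `Q`, `true` = a target of `T`)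
  let nb : Finset α → Finset (Finset α × Bool) := fun a =>
    (if a ∈ B then ∅ else (Q.filter (fun q => a ⊆ q)).image (fun q => (q, false)))
      ∪ (T.filter (fun t => a ⊆ t)).image (fun t => (t, true))
  let ι := {a : Finset α // a ∈ Lft}
  let t : ι → Finset (Finset α × Bool) := fun a => nb a.1
  -- Hall's condition (`passage_hall_condition`)
  have hall : ∀ s : Finset ι, s.card ≤ (s.biUnion t).card := fun s => passage_hall_condition B X hB hX s
  -- the matching
  obtain ⟨f, hfinj, hft⟩ := (Finset.all_card_le_biUnion_card_iff_exists_injective t).1 hall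
  -- every value lies in the right vertex set
  set Rgt : Finset (Finset α × Bool) := Q.image (fun q => (q, false)) ∪ T.image (fun t => (t, true)) with hRgt
  have hnbR : ∀ a, nb a ⊆ Rgt := by
    intro a p hp
    simp only [nb, mem_union, mem_image, mem_filter] at hp
    rw [hRgt, mem_union, mem_image, mem_image]
    rcases hp with hp | hp
    · by_cases haB : a ∈ B
      · simp [haB] at hp
      · simp only [haB, if_false, mem_image, mem_filter] at hp
        obtain ⟨q, ⟨hq, -⟩, rfl⟩ := hp
        exact Or.inl ⟨q, hq, rfl⟩
    · obtain ⟨u, ⟨hu, -⟩, rfl⟩ := hp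
      exact Or.inr ⟨u, hu, rfl⟩
  have hfR : ∀ x : ι, f x ∈ Rgt := fun x => hnbR x.1 (hft x)
  -- counting: #Lft = #Rgt, hence `f` is onto `Rgt`
  have hRd : Disjoint (Q.image (fun q => (q, false))) (T.image (fun t => (t, true))) := by
    rw [disjoint_left]; intro p hp hp'
    rw [mem_image] at hp hp'
    obtain ⟨q, -, rfl⟩ := hp; obtain ⟨t', -, ht'⟩ := hp'
    simpa using congrArg Prod.snd ht'
  have hRcard : Rgt.card = Q.card + T.card := by
    rw [hRgt, card_union_of_disjoint hRd,
      card_image_of_injective _ (fun a b h => by simpa using congrArg Prod.fst h),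
      card_image_of_injective _ (fun a b h => by simpa using congrArg Prod.fst h)]
  have hLcard : Lft.card = O.card + S.card := by rw [hLft, card_union_of_disjoint hOS]
  have hcount : O.card + S.card = Q.card + T.card := by
    -- #O = #refl(B∩X) − #(refl(B∩X) ∩ B), #Q = #S − #(S ∩ refl(B∩X)), #refl(B∩X) = #T, and the two inner sets coincide
    have c1 := card_inter_sdiff_add univ (refl (B ∩ X)) B
    have c2 := card_inter_sdiff_add univ (B ∩ refl X) (refl (B ∩ X))
    simp only [univ_inter] at c1 c2
    have e : refl (B ∩ X) ∩ B = B ∩ refl X ∩ refl (B ∩ X) := by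
      ext s; simp only [mem_inter, refl_inter]; tauto
    have c3 : (refl (B ∩ X)).card = T.card := by rw [hT, card_refl]
    rw [e] at c1
    rw [hO, hQ, hS]
    omega
  have hsurj : ∀ p ∈ Rgt, ∃ x : ι, f x = p := by
    -- `f` as a map into the subtype of `Rgt` is injective between types of equal cardinality
    let g : ι → {p : Finset α × Bool // p ∈ Rgt} := fun x => ⟨f x, hfR x⟩
    have hg : Function.Injective g := by
      intro x y hxy
      apply hfinj
      simpa [g] using congrArg Subtype.val hxy
    have hcard : Fintype.card ι = Fintype.card {p : Finset α × Bool // p ∈ Rgt} := by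
      rw [Fintype.card_coe, Fintype.card_coe, hLcard, hRcard, hcount]
    have hbij : Function.Bijective g := (Fintype.bijective_iff_injective_and_card g).2 ⟨hg, hcard⟩
    intro p hp
    obtain ⟨x, hx⟩ := hbij.2 ⟨p, hp⟩
    exact ⟨x, by simpa [g] using congrArg Subtype.val hx⟩
  -- membership facts extracted from `f x ∈ nb x`
  have fprop : ∀ x : ι, ((f x).2 = true → (f x).1 ∈ T ∧ x.1 ⊆ (f x).1) ∧
      ((f x).2 = false → x.1 ∉ B ∧ (f x).1 ∈ Q ∧ x.1 ⊆ (f x).1) := by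
    intro x
    have hx := hft x
    change f x ∈ nb x.1 at hx
    simp only [nb, mem_union, mem_image, mem_filter] at hx
    rcases hx with hx | hx
    · by_cases hxB : x.1 ∈ B
      · simp [hxB] at hx
      · simp only [hxB, if_false, mem_image, mem_filter] at hx
        obtain ⟨q, ⟨hq, hxq⟩, hfq⟩ := hx
        rw [← hfq]
        exact ⟨fun h => by simp at h, fun _ => ⟨hxB, hq, hxq⟩⟩
    · obtain ⟨u, ⟨hu, hxu⟩, hfu⟩ := hx
      rw [← hfu]
      exact ⟨fun _ => ⟨hu, hxu⟩, fun h => by simp at h⟩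
  -- the thread: for `q ∈ Q`, the left vertex matched to `(q, false)`
  have hQR : ∀ q ∈ Q, (q, false) ∈ Rgt := by
    intro q hq; rw [hRgt, mem_union, mem_image]; exact Or.inl ⟨q, hq, rfl⟩
  choose πι hπι using fun q (hq : q ∈ Q) => hsurj (q, false) (hQR q hq)
  let π : Finset α → Finset α := fun q => if hq : q ∈ Q then (πι q hq).1 else q
  -- membership of `Q` and of `refl (B ∩ X)` in `Lft`
  have hQL : ∀ q ∈ Q, q ∈ Lft := by
    intro q hq; rw [hLft, mem_union]; right; rw [hQ, mem_sdiff] at hq; exact hq.1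
  have hRL : ∀ o ∈ refl (B ∩ X), o ∈ Lft := by
    intro o ho
    rw [hLft, mem_union]
    by_cases hoB : o ∈ B
    · right; rw [hS, mem_inter]; rw [refl_inter, mem_inter] at ho; exact ⟨hoB, ho.2⟩
    · left; rw [hO, mem_sdiff]; exact ⟨ho, hoB⟩
  -- the final target of a left vertex: follow the thread once if necessary
  let tgt : ι → Finset α := fun x =>
    if hx2 : (f x).2 = true then (f x).1
    else (f ⟨(f x).1, hQL _ (((fprop x).2 (by simpa using hx2)).2.1)⟩).1
  -- `tgt x ∈ T` and `x ⊆ tgt x`; if `(f x).2 = false` the thread point `(f x).1` lies in between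
  have tgt_prop : ∀ x : ι, tgt x ∈ T ∧ x.1 ⊆ tgt x := by
    intro x
    by_cases hx2 : (f x).2 = true
    · simp only [tgt, hx2, dif_pos]
      exact (fprop x).1 hx2
    · have hq := (fprop x).2 (by simpa using hx2)
      set y : ι := ⟨(f x).1, hQL _ hq.2.1⟩ with hy
      -- `y ∈ S ⊆ B`, so `f y` is a target
      have hyB : y.1 ∈ B := by
        have : (f x).1 ∈ Q := hq.2.1
        rw [hQ, mem_sdiff, mem_inter] at this; exact this.1.1
      have hy2 : (f y).2 = true := by
        by_contra h
        have h' : (f y).2 = false := by simpa using h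
        exact ((fprop y).2 h').1 hyB
      have hyT := (fprop y).1 hy2
      have htgt : tgt x = (f y).1 := by
        simp only [tgt]
        rw [dif_neg hx2]
      rw [htgt]
      exact ⟨hyT.1, hq.2.2.trans hyT.2⟩
  -- normal forms of `f x` according to its tag
  have f_true : ∀ x : ι, (f x).2 = true → f x = (tgt x, true) := by
    intro x hx2
    simp only [tgt, hx2, dif_pos]
    ext <;> simp [hx2]
  have f_false : ∀ x : ι, (f x).2 = false → f x = ((f x).1, false) := by
    intro x hx2; ext <;> simp [hx2]
  -- for a threaded vertex, the thread point `y` (a left vertex in `Q`) is matched to `(tgt x, true)`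
  have thread : ∀ x : ι, (f x).2 = false →
      ∃ y : ι, y.1 = (f x).1 ∧ y.1 ∈ Q ∧ x.1 ∉ B ∧ x.1 ⊆ y.1 ∧ f y = (tgt x, true) := by
    intro x hx2
    have hq := (fprop x).2 hx2
    let y : ι := ⟨(f x).1, hQL _ hq.2.1⟩
    have hyB : y.1 ∈ B := by
      have : (f x).1 ∈ Q := hq.2.1
      rw [hQ, mem_sdiff, mem_inter] at this; exact this.1.1
    have hy2 : (f y).2 = true := by
      by_contra h
      have h' : (f y).2 = false := by simpa using h
      exact ((fprop y).2 h').1 hyB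
    have htgt : tgt x = (f y).1 := by
      have hx2' : ¬ ((f x).2 = true) := by simp [hx2]
      simp only [tgt]
      rw [dif_neg hx2']
    refine ⟨y, rfl, hq.2.1, hq.1, hq.2.2, ?_⟩
    rw [htgt]; ext <;> simp [hy2]
  -- `Q` is disjoint from `refl (B ∩ X)`
  have hQrefl : ∀ q ∈ Q, q ∉ refl (B ∩ X) := by
    intro q hq; rw [hQ, mem_sdiff] at hq; exact hq.2
  -- injectivity of the final target on `refl (B ∩ X)`
  have tgt_inj : ∀ x x' : ι, x.1 ∈ refl (B ∩ X) → x'.1 ∈ refl (B ∩ X) → tgt x = tgt x' → x = x' := by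
    intro x x' hx hx' h
    by_cases hx2 : (f x).2 = true <;> by_cases hx2' : (f x').2 = true
    · exact hfinj (by rw [f_true x hx2, f_true x' hx2', h])
    · obtain ⟨y', hy'1, hy'Q, -, -, hfy'⟩ := thread x' (by simpa using hx2')
      have hxy' : x = y' := hfinj (by rw [f_true x hx2, hfy', h])
      exact absurd hx (by rw [hxy']; exact hQrefl _ hy'Q)
    · obtain ⟨y, hy1, hyQ, -, -, hfy⟩ := thread x (by simpa using hx2)
      have hxy : x' = y := hfinj (by rw [f_true x' hx2', hfy, h])
      exact absurd hx' (by rw [hxy]; exact hQrefl _ hyQ)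
    · obtain ⟨y, hy1, -, -, -, hfy⟩ := thread x (by simpa using hx2)
      obtain ⟨y', hy'1, -, -, -, hfy'⟩ := thread x' (by simpa using hx2')
      have hyy' : y = y' := hfinj (by rw [hfy, hfy', h])
      apply hfinj
      rw [f_false x (by simpa using hx2), f_false x' (by simpa using hx2'), ← hy1, ← hy'1, hyy']
  -- assemble `Φ` and `π`
  let Φ : Finset α → Finset α := fun a => if ha : a ∈ refl (B ∩ X) then tgt ⟨a, hRL a ha⟩ else a
  have hΦ : ∀ a (ha : a ∈ refl (B ∩ X)), Φ a = tgt ⟨a, hRL a ha⟩ := by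
    intro a ha; simp only [Φ, ha, dif_pos]
  have hπ : ∀ q (hq : q ∈ Q), π q = (πι q hq).1 := by
    intro q hq; simp only [π, hq, dif_pos]
  refine ⟨Φ, π, ?_, ?_, ?_, ?_⟩
  · intro o ho
    rw [hΦ o ho]
    have hp := tgt_prop ⟨o, hRL o ho⟩
    exact ⟨hp.1, hp.2⟩
  · intro a ha a' ha' h
    rw [mem_coe] at ha ha'
    rw [hΦ a ha, hΦ a' ha'] at h
    exact congrArg Subtype.val (tgt_inj _ _ ha ha' h)
  · intro q hqQ
    have hq : q ∈ Q := hqQ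
    rw [hπ q hq]
    set x : ι := πι q hq with hx
    have hfx : f x = (q, false) := hπι q hq
    have hx2 : (f x).2 = false := by rw [hfx]
    obtain ⟨y, hy1, -, hxB, hxy, hfy⟩ := thread x hx2
    have hyq : y.1 = q := by rw [hy1, hfx]
    -- `x.1 ∈ O`
    have hxL : x.1 ∈ O ∪ S := by rw [← hLft]; exact x.2
    rw [mem_union] at hxL
    have hxO : x.1 ∈ O := by
      rcases hxL with h | h
      · exact h
      · exfalso; rw [hS, mem_inter] at h; exact hxB h.1
    have hxO' := hxO
    rw [hO] at hxO'
    have hxrefl : x.1 ∈ refl (B ∩ X) := (mem_sdiff.1 hxO').1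
    have hp := (fprop y).1 (by rw [hfy])
    rw [hfy] at hp
    -- `hp.2 : y.1 ⊆ tgt x`
    have hΦx : Φ x.1 = tgt x := by
      have := hΦ x.1 hxrefl
      rw [this]
    refine ⟨hxO', ?_, ?_⟩
    · rw [← hyq]; exact hxy
    · rw [hΦx, ← hyq]; exact hp.2
  · intro q hq q' hq' h
    rw [mem_coe] at hq hq'
    rw [hπ q hq, hπ q' hq'] at h
    have hxx : πι q hq = πι q' hq' := Subtype.ext h
    have := hπι q hq
    rw [hxx, hπι q' hq'] at this
    simpa using congrArg Prod.fst this.symm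
/-! ### The universal matching -/

/-- **A UNIVERSAL Kleitman matching.**  For up-sets `B, X` of a finite cube there is ONE map `φ`, an upward injection of
`B ∩ refl X` into `B ∩ X` (`s ⊆ φ s`), such that for EVERY up-set `U` the number of `φ`-edges entering `U` from outside is at most the
Kleitman gap of `U` for the pair `(refl (B ∩ X), B ∩ X)`:
`#{s ∈ B ∩ refl X | s ∉ U, φ s ∈ U} + #(U ∩ refl (B ∩ X)) ≤ #(U ∩ B ∩ X)`.
(For each `U` separately this is the splice/hybrid-Kleitman inequality; here one `φ` serves all cuts.)  Proof: take `φ := Φ` on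
`B ∩ refl X ∩ refl (B ∩ X)` and `φ q := Φ (π q)` on `Q`, with `Φ, π` from `exists_passage`; every edge entering `U` from outside is a chord
`o ⊆ Φ o` of the Kleitman bijection with `o ∉ U`, `Φ o ∈ U`, and distinct edges give distinct chords. [this work] -/
theorem exists_universal_matching (B X : Finset (Finset α)) (hB : IsUpperSet (B : Set (Finset α)))
    (hX : IsUpperSet (X : Set (Finset α))) :
    ∃ φ : Finset α → Finset α,
      (∀ s ∈ B ∩ refl X, φ s ∈ B ∩ X ∧ s ⊆ φ s) ∧ Set.InjOn φ ↑(B ∩ refl X) ∧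
      ∀ U : Finset (Finset α), IsUpperSet (U : Set (Finset α)) →
        ((B ∩ refl X).filter (fun s => s ∉ U ∧ φ s ∈ U)).card + (U ∩ refl (B ∩ X)).card ≤ (U ∩ B ∩ X).card := by
  classical
  obtain ⟨Φ, π, hΦ, hΦinj, hπ, hπinj⟩ := exists_passage B X hB hX
  -- the source of the chord carrying `s`
  let src : Finset α → Finset α := fun s => if s ∈ refl (B ∩ X) then s else π s
  let φ : Finset α → Finset α := fun s => Φ (src s)
  have hQmem : ∀ s ∈ B ∩ refl X, s ∉ refl (B ∩ X) → s ∈ (B ∩ refl X) \ refl (B ∩ X) := fun s hs h => mem_sdiff.2 ⟨hs, h⟩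
  -- basic properties of `src`
  have src_prop : ∀ s ∈ B ∩ refl X, src s ∈ refl (B ∩ X) ∧ src s ⊆ s ∧ s ⊆ Φ (src s) := by
    intro s hs
    by_cases h : s ∈ refl (B ∩ X)
    · have hsrc : src s = s := by simp only [src, if_pos h]
      rw [hsrc]
      exact ⟨h, Subset.rfl, (hΦ s h).2⟩
    · have hsrc : src s = π s := by simp only [src, if_neg h]
      rw [hsrc]
      have hq := hπ s (hQmem s hs h)
      exact ⟨(mem_sdiff.1 hq.1).1, hq.2.1, hq.2.2⟩
  have src_inj : Set.InjOn src ↑(B ∩ refl X) := by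
    intro s hs s' hs' h
    rw [mem_coe] at hs hs'
    by_cases h1 : s ∈ refl (B ∩ X) <;> by_cases h2 : s' ∈ refl (B ∩ X)
    · simp only [src, if_pos h1, if_pos h2] at h
      exact h
    · simp only [src, if_pos h1, if_neg h2] at h
      have hq := hπ s' (hQmem s' hs' h2)
      exact absurd (mem_inter.1 hs).1 (by rw [h]; exact (mem_sdiff.1 hq.1).2)
    · simp only [src, if_neg h1, if_pos h2] at h
      have hq := hπ s (hQmem s hs h1)
      exact absurd (mem_inter.1 hs').1 (by rw [← h]; exact (mem_sdiff.1 hq.1).2)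
    · simp only [src, if_neg h1, if_neg h2] at h
      exact hπinj (mem_coe.2 (hQmem s hs h1)) (mem_coe.2 (hQmem s' hs' h2)) h
  refine ⟨φ, ?_, ?_, ?_⟩
  · intro s hs
    have hp := src_prop s hs
    exact ⟨(hΦ _ hp.1).1, hp.2.2⟩
  · intro s hs s' hs' h
    have hp := src_prop s (mem_coe.1 hs); have hp' := src_prop s' (mem_coe.1 hs')
    exact src_inj hs hs' (hΦinj (mem_coe.2 hp.1) (mem_coe.2 hp'.1) h)
  · intro U hU
    -- crossing edges inject (via `src`) into the chords of `Φ` that enter `U` from outside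
    set C : Finset (Finset α) := (B ∩ refl X).filter (fun s => s ∉ U ∧ φ s ∈ U) with hC
    set D : Finset (Finset α) := (refl (B ∩ X)).filter (fun o => o ∉ U ∧ Φ o ∈ U) with hD
    have hCD : C.card ≤ D.card := by
      refine card_le_card_of_injOn src (fun s hs => ?_) (fun s hs s' hs' h => ?_)
      · rw [mem_coe, hC, mem_filter] at hs
        have hp := src_prop s hs.1
        rw [mem_coe, hD, mem_filter]
        refine ⟨hp.1, fun hsu => hs.2.1 (hU hp.2.1 hsu), hs.2.2⟩
      · rw [hC, coe_filter] at hs hs'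
        exact src_inj (mem_coe.2 hs.1) (mem_coe.2 hs'.1) h
    -- chords entering `U` from outside plus antipodal points inside `U` inject into targets inside `U`
    have hDU : D.card + (U ∩ refl (B ∩ X)).card ≤ (U ∩ B ∩ X).card := by
      have hdisj : Disjoint D (U ∩ refl (B ∩ X)) := by
        rw [disjoint_left]; intro o ho ho'
        rw [hD, mem_filter] at ho; rw [mem_inter] at ho'
        exact ho.2.1 ho'.1
      rw [← card_union_of_disjoint hdisj]
      refine card_le_card_of_injOn Φ (fun o ho => ?_) (fun o ho o' ho' h => ?_)
      · rw [mem_coe, mem_union] at ho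
        rw [mem_coe, mem_inter, mem_inter]
        rcases ho with ho | ho
        · rw [hD, mem_filter] at ho
          exact ⟨⟨ho.2.2, (mem_inter.1 (hΦ o ho.1).1).1⟩, (mem_inter.1 (hΦ o ho.1).1).2⟩
        · rw [mem_inter] at ho
          have h1 := hΦ o ho.2
          exact ⟨⟨hU h1.2 ho.1, (mem_inter.1 h1.1).1⟩, (mem_inter.1 h1.1).2⟩
      · have m : ∀ o ∈ (D ∪ (U ∩ refl (B ∩ X)) : Finset (Finset α)), o ∈ refl (B ∩ X) := by
          intro o ho
          rw [mem_union] at ho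
          rcases ho with ho | ho
          · rw [hD, mem_filter] at ho; exact ho.1
          · exact (mem_inter.1 ho).2
        exact hΦinj (mem_coe.2 (m o (mem_coe.1 ho))) (mem_coe.2 (m o' (mem_coe.1 ho'))) h
    omega

end FiveUpSet

end Summit.CriticalPhenomena.PercolationContinuityZ3.Theorems
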